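import Summits.QuantumFields.BalabanUV.Beta.MultiscaleGradientCovariantCases

/-!
# `Summit.QuantumFields.BalabanUV.Beta.MultiscaleGradientCovariantStep` — THE LOCAL (per-bond) INEQUALITY OF THE COVARIANT GRADIENT
# MEMBER FOR `levelOp`, BOTH CASES JOINED: `‖(D_R (levelOp)⁻¹u)(x,μ)‖ ≤ |c₀|√|Cp|·T_cov·n(x)e^{−δ d_n(x,t_{k′})}m + (2dK₂σ₁√|Cp|)·Y`
# (file A3 of the levelOp twin of the owner's 19b under road P3's reduction «rough-`Rm` gradient member ⇐ flat interior estimate (FG) +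
# sup member + ONE (3.35)-shaped binder (SF)», claim «COVARIANT-FLAT-SPLIT»)

HONEST FRAMING (page 1 of everything in this cell).  Discharging `FlowStep.BetaPertH` would make Bałaban's ultraviolet
stability UNCONDITIONAL — a constructive-QFT result; it is NOT the continuum limit and NOT the Clay problem.  This module
discharges nothing of `BetaPertH`; it is [folklore] finite-dimensional bookkeeping about the MODEL operator, kernel-checked, by CO-OWNER #3
of binder row D4 (unit `b2b-balaban-beta-d4-p3`, road P3 «reduction road», gen 13), in the OWNER's file-19b setting and letters.
HONEST DEPENDENCY: continuum YM on T⁴ ⇐ BetaPertH ∧ nine spine estimates (0/9 proved); BetaPertH ⇐ (D1) ∧ (D4) ∧ CAP+tail; G-an2-4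
gates asym, D1 and NE2/3/4.

THE POINT.  **`covariant_grad_local`**: in 19b's section setting minus `hflat`, modulo (FG) ∧ (SF) (HYPOTHESES — ABSOLUTE RULE), for
`f = (levelOp)⁻¹u`, a bond `(x, μ)`, `R₀ = ⌊n(x)θ/4⌋` and `Y ≥ 0` bounding `‖D_R f‖` on the bonds starting in `{dist(·,x) ≤ 2R₀+3}` (needed only
in the good case): `‖(D_R f)((x,μ),·)‖ ≤ |c₀|√|Cp|·T_cov·n(x)·e^{−δ·d_n(x,t_{k′})}·m + (2dK₂σ₁√|Cp|)·Y`,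
`T_cov = 𝔅(Γ²e^δ + 1)·16dΓ + √|Cp|K₁𝔅Γ²e^δ·16dΓ + √|Cp|K₂(θ/4+1)(e^{δ(2d+1)} + a_max√|Cp|𝔅e^{δ(4d+1)})/c₀² + √|Cp|K₂d(σ₂+σ₁²)𝔅Γ²e^δ·16dΓ
+ σ₁𝔅Γ²e^δ·16dΓ` (file A2's two cases; the radius arithmetic of 19b).  The feedback coefficient `2dK₂σ₁√|Cp|` is SCALE-FREE — file B's
bootstrap (`ScaleBootstrap.bootstrap_of_local`) closes iff it is small against the growth of `n·e^{−δd_n}` across a box (print's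
«Mα₀ ≤ a₀»).  WHAT THIS IS NOT: not a bound on Bałaban's ∇_UG′(U); (3.35) p. 396 is a LOCATOR; row D4 readiness width 0; D4 DISCHARGE NO DATE.
LOCATORS (shape only; ABSOLUTE RULE): [Balaban1985BackgroundPropagators] (3.35) p. 396, Thm 3.1 (3.42) p. 397; [Balaban1983RegularityDecay]
Lemma 2.2 (2.17) pp. 577–578.  NOT BetaPertH, NOT continuum, NOT Clay, NOT summit progress.
-/

open scoped BigOperators
open Finset

namespace Summit.QuantumFields.BalabanUV.Beta.MultiscaleGradientCovariantStep

open Summit.QuantumFields.BalabanUV.Beta.BoxPoincare (Box)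
open Summit.QuantumFields.BalabanUV.Beta.MultiscaleCoerciveTorus
open Summit.QuantumFields.BalabanUV.Beta.MultiscaleDistance
open Summit.QuantumFields.BalabanUV.Beta.MultiscaleDistanceMetric (sdist_comm sdist_triangle_torus)
open Summit.QuantumFields.BalabanUV.Beta.MultiscaleDecayBudget
open Summit.QuantumFields.BalabanUV.Beta.MultiscaleDecay (decay_levelOp)
open Summit.QuantumFields.BalabanUV.Beta.AccretiveCombesThomasSandwichSite (sdist_corner_thresholds)
open Summit.QuantumFields.BalabanUV.Beta.MultiscaleBoxDistance (sdist_le_of_dist_le)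
open Summit.QuantumFields.BalabanUV.Beta.MultiscaleRegularityClosed (real_sup_levelOp_inverse_le)
open Summit.QuantumFields.BalabanUV.Beta.MultiscaleGradientSource (abs_le_on_unit_ball abs_levelSum_le_on_unit_ball)
open Summit.QuantumFields.BalabanUV.Beta.SubsolutionMeanValueBox (Cmv Cmv_pos)
open Summit.QuantumFields.BalabanUV.Beta.CovariantKato (sqrt_sum_sq_add_le sqrt_sum_sq_smul sqrt_sum_sq_Rm)
open Summit.QuantumFields.BalabanUV.Beta.CovariantGradientBox (norm_le_sqrt_card_of_abs_le covariant_fdiff_le_box)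
open Literature.MathematicalPhysics.QuantumFieldTheory.Balaban1983to89
open Literature.MathematicalPhysics.QuantumFieldTheory.Balaban1983to89.B9Thm37Glue (covD covDT covD_apply covDT_apply)
open Literature.MathematicalPhysics.QuantumFieldTheory.Balaban1983to89.B9Thm37GluePU (bsrc btgt bsrc_apply btgt_apply)
open Literature.MathematicalPhysics.QuantumFieldTheory.Balaban1983to89.B9Thm37GlueTorusCov (tblk)
open Literature.MathematicalPhysics.QuantumFieldTheory.Balaban1983to89.B9Thm37GlueTorusCovLevels (levelOp levelSum)
open B5TorusCover (UT Ctr ctrU)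
open B5Leibniz121 (up dn)

open Summit.QuantumFields.BalabanUV.Beta.MultiscaleGradientCovariantCases (covariant_grad_local_good covariant_grad_local_small)

noncomputable section

variable {d : ℕ} {N : Fin d → ℕ} [∀ i, NeZero (N i)]

section Main


variable [NeZero d] {Cp J K : Type} [Fintype Cp] [DecidableEq Cp] [Nonempty Cp]
  [Fintype J] [Fintype K] [DecidableEq K] (S : J → ℕ) (hS : ∀ l, 1 ≤ S l) (hdivS : ∀ l i, S l ∣ N i) (lvl : K → J)
  (zc : (k : K) → Ctr N (S (lvl k)))
  (hdisj : ∀ k k' v v', cellPt S hS hdivS lvl zc k v = cellPt S hS hdivS lvl zc k' v' → k = k')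
  (hcover : ∀ x : UT N, ∃ k, ∃ v : Box d (S (lvl k)), cellPt S hS hdivS lvl zc k v = x)
  (Rm : UT N × Fin d → Cp → Cp → ℝ) (hRm : ∀ b i j, ∑ k, Rm b k i * Rm b k j = if i = j then (1 : ℝ) else 0)
  (T : J → UT N → Cp → Cp → ℝ) (hT : ∀ l x i i', ∑ k, T l x k i * T l x k i' = if i = i' then (1 : ℝ) else 0)
  (a : J → ℝ) (ha : ∀ j, 0 ≤ a j) (ω : J → UT N → ℝ)
  (hsupp : ∀ l x, ω l (ctrU N (S l) (tblk (hS l) (hdivS l) x)) ≠ 0 → ∃ k v, lvl k = l ∧ cellPt S hS hdivS lvl zc k v = x)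
  {amax : ℝ} (hamax : 0 ≤ amax)
  (hscale : ∀ k, a (lvl k) * ω (lvl k) (ctrU N (S (lvl k)) (zc k)) ^ 2 * (S (lvl k) : ℝ) ^ d ≤ amax / (S (lvl k) : ℝ) ^ 2)
  (c : UT N × Fin d → ℝ) {c₀ : ℝ} (hcc : ∀ b, c b = c₀) (hc₀ : c₀ ≠ 0)
  {L : ℕ} (hL : 1 ≤ L) (e : J → ℕ) (hSe : ∀ l, S l = L ^ e l) {R : ℝ} (hR : 0 < R) {A : ℕ}
  (hadd : ∀ x y : UT N, |(e (lvl (cellOf S hS hdivS lvl zc hcover x)) : ℝ) - e (lvl (cellOf S hS hdivS lvl zc hcover y))| ≤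
    A + sdist bsrc btgt (siteScale S hS hdivS lvl zc hcover) x y / R)

include hdisj hT ha hsupp hamax hscale hL e hSe hR hadd hRm hcc hc₀

/-- **THE LOCAL INEQUALITY OF THE COVARIANT GRADIENT MEMBER FOR `levelOp`, MODULO (FG) ∧ (SF).**  In the MODEL setting of file 19b
(`MultiscaleGradientMember.real_grad_levelOp_inverse_le_of_flatGradient`) WITHOUT the flatness of `Rm` (any column-orthonormal transports),
with the flat binder (FG) (constants `K₁, K₂ ≥ 0`) and the (3.35)-SHAPED binder (SF) with constants `σ₁, σ₂ ≥ 0` («for every centre `x₀`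
at its natural radius `R = ⌊n(x₀)θ/4⌋ ≥ 1` there is a sitewise column-orthonormal gauge `g`, with transformed transporters `R^g_b = g(b₋)R_b g(b₊)ᵀ`, such that
`‖(R^g_b − 1)v‖ ≤ σ₁/(R+1)·‖v‖` for the bonds starting in `{dist(·,x₀) ≤ 2R+3}` and `‖(R^g_{(x′−e_μ,μ)} − R^g_{(x′,μ)})v‖ ≤ σ₂/(R+1)²·‖v‖` for
`dist(x′,x₀) ≤ 2R+2`» — a HYPOTHESIS, ABSOLUTE RULE).  Let `u` be supported in cell `k′` with `|u| ≤ m`, `f = (levelOp)⁻¹u`, `(x, μ)` a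
bond, `R₀ = ⌊n(x)θ/4⌋`, and `Y ≥ 0` a bound of `‖(D_R f)(b)‖` on the bonds starting in `{dist(·,x) ≤ 2R₀+3}` (used only when `R₀ ≥ 1`
and `10R₀ + 4 ≤ N_j`).  THEN `‖(D_R f)((x,μ),·)‖ ≤ |c₀|√|Cp|·T_cov·n(x)·e^{−δ·d_n(x,t_{k′})}·m + (2dK₂σ₁√|Cp|)·Y`.
[cite: Balaban1985BackgroundPropagators, Thm 3.1 (3.42) p.397 + (3.35) p.396] [folklore] -/
theorem covariant_grad_local {cmax : ℝ} (hc : ∀ b, |c b| ≤ cmax) {C : ℝ}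
    (hcoer : ∀ f : UT N × Cp → ℝ,
      C * ∑ k, ((S (lvl k) : ℝ) ^ 2)⁻¹ * ∑ v : Box d (S (lvl k)), ∑ i, f (cellPt S hS hdivS lvl zc k v, i) ^ 2 ≤
        ∑ p, f p * levelOp bsrc btgt c Rm (fun l x => ctrU N (S l) (tblk (hS l) (hdivS l) x))
          (fun l x => ω l (ctrU N (S l) (tblk (hS l) (hdivS l) x))) T a f p)
    {κ : ℝ} (hκ0 : 0 ≤ κ) (hκ1 : κ ≤ 1) (hμ : 0 < C - 2 * d * cmax ^ 2 * κ ^ 2 - amax * (Real.exp (2 * d * κ) - 1))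
    (hrate : (1 + d / 2) * (Real.log L / R) ≤ κ)
    {Γ θ δ 𝔅 : ℝ} (hΓ : Γ = (L : ℝ) ^ A * Real.exp (Real.log L / R * (4 * d + 1))) (hθ : θ = 1 / (4 * d * Γ))
    (hδ : δ = κ - (1 + d / 2) * (Real.log L / R))
    (h𝔅 : 𝔅 = (max (Real.sqrt (11 ^ d)) (Cmv d * Real.sqrt (21 ^ d)) / Real.sqrt (θ ^ d) +
            Real.sqrt (Fintype.card Cp) * (θ + 1) ^ 2 * (amax * Γ ^ 2 * Real.sqrt (Γ ^ d)) / (2 * c₀ ^ 2)) *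
          (Real.sqrt (Fintype.card Cp) * Real.exp (κ * ((4 * d + 1) + 2 * d)) *
            ((L : ℝ) ^ A * Real.exp (Real.log L / R * (4 * d + 1))) * (L : ℝ) ^ A * Real.sqrt (((L : ℝ) ^ A) ^ d) /
            (C - 2 * d * cmax ^ 2 * κ ^ 2 - amax * (Real.exp (2 * d * κ) - 1))) +
          Real.sqrt (Fintype.card Cp) * (θ + 1) ^ 2 / (2 * c₀ ^ 2) *
            Real.exp ((κ - (1 + d / 2) * (Real.log L / R)) * ((4 * d + 1) + 2 * d)))
    {K₁ K₂ : ℝ} (hK₁ : 0 ≤ K₁) (hK₂ : 0 ≤ K₂)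
    (hFG : ∀ (x₀ : UT N) (R : ℕ), 1 ≤ R → (∀ i, 10 * R + 4 ≤ N i) → ∀ (w : UT N → ℝ) (M G : ℝ),
      (∀ x ∈ univ.filter (fun x : UT N => dist x x₀ ≤ 2 * R + 2), |w x| ≤ M) →
      (∀ x ∈ univ.filter (fun x : UT N => dist x x₀ ≤ 2 * R + 2),
        |((∑ b ∈ univ.filter (fun b : UT N × Fin d => btgt b = x), c b ^ 2) +
              ∑ b ∈ univ.filter (fun b : UT N × Fin d => bsrc b = x), c b ^ 2) * w x -
            ((∑ b ∈ univ.filter (fun b : UT N × Fin d => btgt b = x), c b ^ 2 * w (bsrc b)) +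
              ∑ b ∈ univ.filter (fun b : UT N × Fin d => bsrc b = x), c b ^ 2 * w (btgt b))| ≤ G) →
      ∀ μ, |w (up x₀ μ) - w x₀| ≤ K₁ * M / ((R : ℝ) + 1) + K₂ * ((R : ℝ) + 1) * G / c₀ ^ 2)
    {σ₁ σ₂ : ℝ} (hσ₁ : 0 ≤ σ₁) (hσ₂ : 0 ≤ σ₂)
    (hSF : ∀ (x₀ : UT N) (R : ℕ), 1 ≤ R → (R : ℝ) ≤ (siteScale S hS hdivS lvl zc hcover x₀ : ℝ) * θ / 4 →
      (siteScale S hS hdivS lvl zc hcover x₀ : ℝ) * θ / 4 < R + 1 → ∃ g : UT N → Cp → Cp → ℝ, ∃ Rg : UT N × Fin d → Cp → Cp → ℝ,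
      (∀ x i j, ∑ k, g x k i * g x k j = if i = j then (1 : ℝ) else 0) ∧
      (∀ b i j, Rg b i j = ∑ k, g (bsrc b) i k * ∑ l, Rm b k l * g (btgt b) j l) ∧
      (∀ b : UT N × Fin d, dist (bsrc b) x₀ ≤ 2 * R + 3 → ∀ v : Cp → ℝ,
        Real.sqrt (∑ i, (∑ j, (Rg b i j - if i = j then (1 : ℝ) else 0) * v j) ^ 2) ≤
          σ₁ / ((R : ℝ) + 1) * Real.sqrt (∑ j, v j ^ 2)) ∧
      (∀ x ∈ univ.filter (fun x : UT N => dist x x₀ ≤ 2 * R + 2), ∀ μ (v : Cp → ℝ),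
        Real.sqrt (∑ i, (∑ j, (Rg (dn x μ, μ) i j - Rg (x, μ) i j) * v j) ^ 2) ≤
          σ₂ / ((R : ℝ) + 1) ^ 2 * Real.sqrt (∑ j, v j ^ 2)))
    (k' : K) (u : UT N × Cp → ℝ) (hu : ∀ p, cellOf S hS hdivS lvl zc hcover p.1 ≠ k' → u p = 0)
    {m : ℝ} (hm : 0 ≤ m) (hum : ∀ p, |u p| ≤ m) (f : UT N × Cp → ℝ)
    (hf : f = (Ring.inverse (levelOp bsrc btgt c Rm (fun l x => ctrU N (S l) (tblk (hS l) (hdivS l) x))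
        (fun l x => ω l (ctrU N (S l) (tblk (hS l) (hdivS l) x))) T a)) u)
    (x : UT N) (μ : Fin d) {Y : ℝ} (hY0 : 0 ≤ Y)
    (hY : (1 ≤ ⌊(siteScale S hS hdivS lvl zc hcover x : ℝ) * θ / 4⌋₊ ∧
        ∀ j, 10 * ⌊(siteScale S hS hdivS lvl zc hcover x : ℝ) * θ / 4⌋₊ + 4 ≤ N j) →
      ∀ b : UT N × Fin d, dist (bsrc b) x ≤ 2 * ⌊(siteScale S hS hdivS lvl zc hcover x : ℝ) * θ / 4⌋₊ + 3 →
        Real.sqrt (∑ i, covD bsrc btgt c Rm f (b, i) ^ 2) ≤ Y) :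
    Real.sqrt (∑ i, covD bsrc btgt c Rm f ((x, μ), i) ^ 2) ≤
      |c₀| * Real.sqrt (Fintype.card Cp) *
          (𝔅 * (Γ ^ 2 * Real.exp δ + 1) * (16 * d * Γ) + Real.sqrt (Fintype.card Cp) * K₁ * 𝔅 * Γ ^ 2 * Real.exp δ * (16 * d * Γ) +
            Real.sqrt (Fintype.card Cp) * K₂ * (θ / 4 + 1) *
              (Real.exp (δ * (2 * d + 1)) + amax * Real.sqrt (Fintype.card Cp) * 𝔅 * Real.exp (δ * (4 * d + 1))) / c₀ ^ 2 +
            Real.sqrt (Fintype.card Cp) * K₂ * (d * (σ₂ + σ₁ ^ 2)) * 𝔅 * Γ ^ 2 * Real.exp δ * (16 * d * Γ) +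
            σ₁ * 𝔅 * Γ ^ 2 * Real.exp δ * (16 * d * Γ)) *
        (siteScale S hS hdivS lvl zc hcover x : ℝ) *
        Real.exp (-(δ * sdist bsrc btgt (siteScale S hS hdivS lvl zc hcover) x (ctrU N (S (lvl k')) (zc k')))) * m
      + 2 * d * K₂ * σ₁ * Real.sqrt (Fintype.card Cp) * Y := by
  classical
  set n := siteScale S hS hdivS lvl zc hcover with hn
  -- positivity
  have hd1 : (1 : ℝ) ≤ d := by exact_mod_cast Nat.one_le_iff_ne_zero.mpr (NeZero.ne d)
  have hd0 : (0 : ℝ) < d := by linarith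
  have hL1 : (1 : ℝ) ≤ L := by exact_mod_cast hL
  have ht0 : 0 ≤ Real.log L / R := div_nonneg (Real.log_nonneg hL1) hR.le
  have hΓ1 : 1 ≤ Γ := by
    rw [hΓ]
    exact one_le_mul_of_one_le_of_one_le (one_le_pow₀ hL1) (Real.one_le_exp (mul_nonneg ht0 (by positivity)))
  have hΓ0 : 0 < Γ := by linarith
  have hdΓ : (1 : ℝ) ≤ d * Γ := one_le_mul_of_one_le_of_one_le hd1 hΓ1
  have hθ0 : 0 < θ := by rw [hθ]; positivity
  have hθ4 : θ ≤ 1 / 4 := by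
    rw [hθ]
    refine div_le_div_of_nonneg_left zero_le_one (by norm_num) ?_
    have : (4 : ℝ) * d * Γ = 4 * (d * Γ) := by ring
    rw [this]; linarith
  have hθΓ : θ * (16 * d * Γ) = 4 := by rw [hθ]; field_simp; ring
  have hδ0 : 0 ≤ δ := by rw [hδ]; linarith
  have hKc0 : 0 ≤ Real.sqrt (Fintype.card Cp) := Real.sqrt_nonneg _
  have h𝔅0 : 0 ≤ 𝔅 := by rw [h𝔅]; positivity
  have hnpos : ∀ y, (0 : ℝ) < (n y : ℝ) := fun y => by exact_mod_cast one_le_siteScale S hS hdivS lvl zc hcover y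
  -- the common factor is nonnegative, and T₁, feedback are nonnegative
  have hE0 : 0 ≤ (n x : ℝ) * Real.exp (-(δ * sdist bsrc btgt n x (ctrU N (S (lvl k')) (zc k')))) * m := by positivity
  have hT1n : 0 ≤ 𝔅 * (Γ ^ 2 * Real.exp δ + 1) * (16 * d * Γ) := by positivity
  have hTgn : 0 ≤ (Real.sqrt (Fintype.card Cp) * K₁ * 𝔅 * Γ ^ 2 * Real.exp δ * (16 * d * Γ) +
            Real.sqrt (Fintype.card Cp) * K₂ * (θ / 4 + 1) *
              (Real.exp (δ * (2 * d + 1)) + amax * Real.sqrt (Fintype.card Cp) * 𝔅 * Real.exp (δ * (4 * d + 1))) / c₀ ^ 2 +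
            Real.sqrt (Fintype.card Cp) * K₂ * (d * (σ₂ + σ₁ ^ 2)) * 𝔅 * Γ ^ 2 * Real.exp δ * (16 * d * Γ) +
            σ₁ * 𝔅 * Γ ^ 2 * Real.exp δ * (16 * d * Γ)) := by positivity
  have hfb0 : 0 ≤ 2 * d * K₂ * σ₁ * Real.sqrt (Fintype.card Cp) * Y := by positivity
  -- the radius
  set R₀ : ℕ := ⌊(n x : ℝ) * θ / 4⌋₊ with hR₀
  have hR₀le : (R₀ : ℝ) ≤ n x * θ / 4 := Nat.floor_le (by positivity)
  have hR₀lt : (n x : ℝ) * θ / 4 < R₀ + 1 := Nat.lt_floor_add_one _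
  by_cases hcase : 1 ≤ R₀ ∧ ∀ j, 10 * R₀ + 4 ≤ N j
  · obtain ⟨hR1, hroom⟩ := hcase
    have h := covariant_grad_local_good S hS hdivS lvl zc hdisj hcover Rm hRm T hT a ha ω hsupp hamax hscale c hcc hc₀ hL e hSe hR
      hadd hc hcoer hκ0 hκ1 hμ hrate hΓ hθ hδ h𝔅 hK₁ hK₂ hFG hσ₁ hσ₂ hSF k' u hu hm hum f hf x μ hR1 hroom hR₀le hR₀lt hY0
      (hY ⟨hR1, hroom⟩)
    have hmono : |c₀| * Real.sqrt (Fintype.card Cp) *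
        (Real.sqrt (Fintype.card Cp) * K₁ * 𝔅 * Γ ^ 2 * Real.exp δ * (16 * d * Γ) +
            Real.sqrt (Fintype.card Cp) * K₂ * (θ / 4 + 1) *
              (Real.exp (δ * (2 * d + 1)) + amax * Real.sqrt (Fintype.card Cp) * 𝔅 * Real.exp (δ * (4 * d + 1))) / c₀ ^ 2 +
            Real.sqrt (Fintype.card Cp) * K₂ * (d * (σ₂ + σ₁ ^ 2)) * 𝔅 * Γ ^ 2 * Real.exp δ * (16 * d * Γ) +
            σ₁ * 𝔅 * Γ ^ 2 * Real.exp δ * (16 * d * Γ)) *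
        ((n x : ℝ) * Real.exp (-(δ * sdist bsrc btgt n x (ctrU N (S (lvl k')) (zc k')))) * m) ≤
        |c₀| * Real.sqrt (Fintype.card Cp) *
        (𝔅 * (Γ ^ 2 * Real.exp δ + 1) * (16 * d * Γ) + Real.sqrt (Fintype.card Cp) * K₁ * 𝔅 * Γ ^ 2 * Real.exp δ * (16 * d * Γ) +
            Real.sqrt (Fintype.card Cp) * K₂ * (θ / 4 + 1) *
              (Real.exp (δ * (2 * d + 1)) + amax * Real.sqrt (Fintype.card Cp) * 𝔅 * Real.exp (δ * (4 * d + 1))) / c₀ ^ 2 +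
            Real.sqrt (Fintype.card Cp) * K₂ * (d * (σ₂ + σ₁ ^ 2)) * 𝔅 * Γ ^ 2 * Real.exp δ * (16 * d * Γ) +
            σ₁ * 𝔅 * Γ ^ 2 * Real.exp δ * (16 * d * Γ)) *
        ((n x : ℝ) * Real.exp (-(δ * sdist bsrc btgt n x (ctrU N (S (lvl k')) (zc k')))) * m) :=
      mul_le_mul_of_nonneg_right (mul_le_mul_of_nonneg_left (by linarith) (by positivity)) hE0
    linarith [h, hmono]
  · -- small scale
    have hnx : (n x : ℝ) ≤ 16 * d * Γ := by
      by_cases hR1 : 1 ≤ R₀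
      · have hex : ∃ j, N j < 10 * R₀ + 4 := by
          by_contra hcon
          push Not at hcon
          exact hcase ⟨hR1, hcon⟩
        obtain ⟨j, hj⟩ := hex
        have hnN : n x ≤ N j := Nat.le_of_dvd (Nat.pos_of_ne_zero (NeZero.ne _)) (by rw [hn]; exact hdivS _ j)
        have hjR : (N j : ℝ) < 10 * R₀ + 4 := by exact_mod_cast hj
        have hnNR : (n x : ℝ) ≤ N j := by exact_mod_cast hnN
        have hRn : (R₀ : ℝ) ≤ n x / 16 := by
          have : (n x : ℝ) * θ ≤ n x * (1 / 4) := mul_le_mul_of_nonneg_left hθ4 (hnpos x).le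
          calc (R₀ : ℝ) ≤ n x * θ / 4 := hR₀le
            _ ≤ n x * (1 / 4) / 4 := by linarith
            _ = n x / 16 := by ring
        linarith
      · push Not at hR1
        have hR0 : R₀ = 0 := by omega
        have hlt : (n x : ℝ) * θ / 4 < 1 := by
          have h := hR₀lt
          rw [hR0] at h
          simpa using h
        have : (n x : ℝ) * θ / 4 * (16 * d * Γ) < 1 * (16 * d * Γ) := mul_lt_mul_of_pos_right hlt (by positivity)
        have e1 : (n x : ℝ) * θ / 4 * (16 * d * Γ) = n x * (θ * (16 * d * Γ)) / 4 := by ring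
        rw [e1, hθΓ] at this
        linarith
    have h := covariant_grad_local_small S hS hdivS lvl zc hdisj hcover Rm hRm T hT a ha ω hsupp hamax hscale c hcc hc₀ hL e hSe hR
      hadd hc hcoer hκ0 hκ1 hμ hrate hΓ hθ hδ h𝔅 k' u hu hm hum f hf x μ hnx
    have hmono : |c₀| * Real.sqrt (Fintype.card Cp) * (𝔅 * (Γ ^ 2 * Real.exp δ + 1) * (16 * d * Γ)) *
        ((n x : ℝ) * Real.exp (-(δ * sdist bsrc btgt n x (ctrU N (S (lvl k')) (zc k')))) * m) ≤
        |c₀| * Real.sqrt (Fintype.card Cp) *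
        (𝔅 * (Γ ^ 2 * Real.exp δ + 1) * (16 * d * Γ) + Real.sqrt (Fintype.card Cp) * K₁ * 𝔅 * Γ ^ 2 * Real.exp δ * (16 * d * Γ) +
            Real.sqrt (Fintype.card Cp) * K₂ * (θ / 4 + 1) *
              (Real.exp (δ * (2 * d + 1)) + amax * Real.sqrt (Fintype.card Cp) * 𝔅 * Real.exp (δ * (4 * d + 1))) / c₀ ^ 2 +
            Real.sqrt (Fintype.card Cp) * K₂ * (d * (σ₂ + σ₁ ^ 2)) * 𝔅 * Γ ^ 2 * Real.exp δ * (16 * d * Γ) +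
            σ₁ * 𝔅 * Γ ^ 2 * Real.exp δ * (16 * d * Γ)) *
        ((n x : ℝ) * Real.exp (-(δ * sdist bsrc btgt n x (ctrU N (S (lvl k')) (zc k')))) * m) :=
      mul_le_mul_of_nonneg_right (mul_le_mul_of_nonneg_left (by linarith) (by positivity)) hE0
    linarith [h, hmono]

end Main

end

end Summit.QuantumFields.BalabanUV.Beta.MultiscaleGradientCovariantStep
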